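import Mathlib
import HarnessLib
import HarnessLib.Audit
import Summits.FinalStateConjecture.Statement
import Literature.Geometry.Lorentzian.CutBondiMass

/-!
Route: BondiDrainDispersal

DORMANT since 2026-09-04T23:03:08Z (reconciler: no traction for 5 d (last activity item-evidence-added at 2026-08-30T22:29:22Z); parked, not closed — `ledger route dormant route-FinalStateConjecture-BondiDrainDispersal --off` to reactiv) — unstaffed, not closed; items shared with open routes are served there. `ledger route dormant <id> --off` reactivates.

# Route BondiDrainDispersal — no horizon ⇒ the Bondi mass drains ⇒ (PMT stability on late
hyperboloids: bubbles are holes or nothing) the development disperses — the N = 0 sector, for ALL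
censored Christodoulou–Klainerman data

It suffices to show X = X_disp ∧ X_gen. X_disp (CENSORED HORIZONLESS CK DEVELOPMENTS DISPERSE — no
genericity; rev 7: restricted to the
Christodoulou–Klainerman data class): every maximal vacuum Cauchy development of an admissible datum
(Dafermos–Rodnianski class
`admissibleVacuumData X`) which moreover has a sole STRONGLY ASYMPTOTICALLY FLAT CK END
(`AFEnd.IsStronglyAsymptoticallyFlatCK`:
weighted fall-off (3/2, 5/2) to derivative orders (4, 3), CK 1993 (1.0.9)), and whose development
has complete future null infinity
(sojourn form) and NO EVENT HORIZON — rendered intrinsically: every event lies in the chronological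
past of some future-complete
normalised null ray issued from the data hypersurface — carries an honest dispersive final-state
decomposition (N = 0, region
O = J⁺(ιX) ∩ I⁻(flat chart), every future-complete normalised null ray from X staying in closure O,
exhaustive charts with honest radii,
future-oriented chart time — the Statement's N = 0 conclusion verbatim, re-type T2 of 2026-08-16,
p126844).
The card pmt-almost-rigidity-bubbles-are-holes proves X_disp in two strokes, the rank-4 and rank-2
cruxes (typed over N1 =
`CauchyDevelopment.HasVanishingFinalBondiMass`, CutBondiMass.lean): HorizonlessMustDrain (no horizon
⇒ the Bondi mass M_B(u) ↓ 0, the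
no-soliton theorem at 𝓘⁺; stated for all DR data) and DrainImpliesDisperseCKH (CK data, no horizon,
M_B ↓ 0 ⇒ N = 0: Dong–Song
positive-mass STABILITY on late hyperboloidal slices = mass-ε-regularity, the vacuum dichotomy "a
bubble is a black hole or nothing",
and a weak-to-C² upgrade that is linearly consistent exactly because CK data control FOUR
derivatives of g — REPORT-c3 §2 table).
X_gen (the complementary, generic branch, rev 7 form GenericCensoredHolesOrRoughSettle): for
TAME-generic admissible data
(`IsTameChristodoulouGeneric … 1`: the witness family lives on ONE fixed end, is wDist-continuous at
c = 0 and immersed at 0) an MGHD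
exists, every MGHD has complete 𝓘⁺, and IF it has an event horizon OR the datum is NOT CK-regular
(the rough class DR ∖ CK) its
exterior settles to finitely many sub-extremal Kerrs (rays stay in closure O, exhaustive
future-oriented charts). Only X_gen carries the
genericity quantifier (tame Christodoulou genericity is not closed under ∧), and
FinalStateConjecture ⇒ X_gen (no overshoot).
Lean: `CensoredHorizonlessDisperseCK ∧ GenericCensoredHolesOrRoughSettle`

## Assembly
Pure logic, compiled sorry-free in the planner's Sketch.lean and shipped as the deciding theorem
`closes` (rev 7, LEAF form):
`closes : HorizonlessMustDrain → DrainImpliesDisperseCKH → GenericCensoredHolesOrRoughSettle →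
FinalStateConjecture`. The two strokes
compose to CensoredHorizonlessDisperseCK inside the proof (so all four cruxes lie in its cone); then
fix X and an exceptional datum D of
the Statement's property P; tame Christodoulou genericity is monotone in the property (the SAME end
e and the SAME tame, immersed,
injective admissible family F through D witness the smaller exceptional set), so it suffices that
the property Q of
GenericCensoredHolesOrRoughSettle implies P on the admissible class: given an MGHD 𝒟, Q gives
complete 𝓘⁺, and by excluded middle
either 𝒟 has an event horizon (Q gives the sub-extremal decomposition), or it has none and D is
CK-regular (CensoredHorizonlessDisperseCK
gives an N = 0 decomposition with the same three T2 clauses, whose sub-extremality clause is vacuous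
over Fin 0), or it has none and D is
rough (Q again). Axioms propext / Classical.choice / Quot.sound. (Rev 6 had the same shape over the
DR-class items DrainImpliesDisperse /
CensoredHorizonlessDisperse / GenericCensoredHolesSettle, kept in the file as asides since rev 7.)

Rationale: WHY THIS LINE. Positive-mass RIGIDITY (m = 0 ⇒ flat) is now QUANTITATIVE: Dong–Song
(doi:10.1007/s00222-024-01302-z, arXiv:2302.07414) prove that
asymptotically flat 3-manifolds with R ≥ 0 and m_ADM → 0 converge to ℝ³ (pointed measured GH) after
excising 'bubbles' Z with Area(∂Z) → 0,
by the Bray–Kazaras–Khuri–Stern / Hirsch–Kazaras–Khuri level-set mass formula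
(doi:10.4310/jdg/1669998184), an explicit coercive integral.
Transplanted to the one monotone signed scalar the Einstein flow offers at infinity — the Bondi
mass, non-increasing (Bondi–Sachs,
ChristodoulouKlainerman1993 Ch. 17) and ≥ 0 (SchoenYau1982, LudvigsenVickers1982) — it becomes a
MASS-ε-REGULARITY at late hyperboloidal
slices: M_B ↓ 0 forces flatness modulo bubbles, and in VACUUM a small-neck bubble either hides a
marginally trapped surface (then it is a
black hole and the line's horizon hypothesis excludes it) or is scale-critically small and disperses
(arXiv:1204.1767, arXiv:1409.6270):
bubbles are holes or nothing. Imported areas: geometric analysis of scalar curvature (PMT stability,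
level-set/spacetime-harmonic
functions, Lee–Sormani intrinsic-flat programme) and large-data hyperbolic stability (Luk–Oh
doi:10.1007/s00023-021-01148-8 =
arXiv:2108.13379 for the C² endgame). What it does that nothing filed does: it makes the dispersive
sector of the conjecture a pair of
deterministic Liouville-type statements AT NULL INFINITY ("no horizon ⇒ no final mass ⇒ nothing"),
typed over the audited Statement's own
predicates, with the genericity bookkeeping discharged once and for all in the deciding theorem
(negatives index: empty at filing).

RANKED CRUXES. (Rev 7.) #2 DrainImpliesDisperseCKH (crux; C″ of the crux-directory restatement
package
Cruxes/DrainImpliesDisperse/Surgery_c6.lean, kernel-checked there) — for every admissible datum D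
that moreover has a sole strongly
asymptotically flat CK end (∃ e M, e.IsSoleEnd ∧ e.IsStronglyAsymptoticallyFlatCK D M) and every
maximal vacuum Cauchy development 𝒟 of D
with complete future null infinity (sojourn form) and NO EVENT HORIZON in the intrinsic
ray-theoretic sense (it is false that some event q lies outside the chronological past I⁻(γ(dom ∩
[0,∞))) of every future-complete normalised null ray γ from the data hypersurface): if the final
Bondi mass of 𝒟 vanishes (`HasVanishingFinalBondiMass`, N1), then
there are O and a C² final-state decomposition d with d.N = 0, O = exteriorOf d.charted,
RaysStayInClosure O, HasExhaustiveCharts d and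
IsFutureOriented d — the Statement's N = 0 conclusion verbatim. WHY CK: on the DR class (C² control
of g, C¹ of k) an incoming vacuum
ripple of profile r^(−a) sin(r^b) focuses into curvature pulses of size t^(3b−a−2) at arbitrarily
late times while draining completely
(REPORT-c3 §2, F. John's focusing law, certificate j024863, kernel instance
Literature.Analysis.PDE.not_bddAbove_deriv_deriv_focalValue;
the Negative/ lemmas `drainImpliesDisperse_false_of_*` certify ¬DrainImpliesDisperse modulo the
construction items
RoughFramedAxisPulses(Data)DevelopmentExists), whereas the CK orders (4, 3) make every focused C^k
size, k ≤ 3, decay (§2 table: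
a pointwise C^k conclusion is linearly consistent iff n_h ≥ k + 1). WHY H: `closes` applies the crux
only in the horizonless branch, so
the hypothesis costs the route nothing and removes the unproved late-cut Penrose ('massless hole')
channel (REPORT-c6 §2.1). Registered
line: Cruxes/DrainImpliesDisperse/Lines/birth.lean r4,
`Birth.DrainImpliesDisperseCKH_of_visibleRadiativeEnd` (engine E1–E5 + E6♭,
the visible radiative end, on p149007 `settles_of_horizonlessRadiativeEnd` and p166259).
[difficulty: open-problem]
#3 CensoredHorizonlessDisperseCK (crux) — the composite: for every admissible datum with a sole CK
end and every MGHD with complete 𝓘⁺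
and no event horizon (same sense), the honest N = 0 decomposition exists. HorizonlessMustDrain →
DrainImpliesDisperseCKH →
CensoredHorizonlessDisperseCK by pure logic (the `have hA` of `closes`); a direct proof of it plus
#5 gives the Statement.
[difficulty: open-problem]
#4 HorizonlessMustDrain (crux; textually unchanged since rev 2, stated for ALL DR-admissible data —
`closes` uses it on CK data only) —
censored + horizonless ⇒ the final Bondi mass vanishes: the no-soliton theorem at 𝓘⁺. Registered
line:
Cruxes/HorizonlessMustDrain/Lines/birth.lean (stub_completeSector / stub_incompleteSector).
[difficulty: open-problem]
#5 GenericCensoredHolesOrRoughSettle (crux; the route's declared RESIDUAL — the summit-complement of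
the dispersive sector) — for every
data manifold X, tame-Christodoulou-generically in the admissible class: an MGHD exists, and every
MGHD has complete 𝓘⁺ and, IF it has an
event horizon OR the datum has no sole CK end, admits O and a C² final-state decomposition with
every (mass, spin) sub-extremal,
O = exteriorOf d.charted, RaysStayInClosure, HasExhaustiveCharts, IsFutureOriented. It is the
WEAKEST single generic property Q with
Q ∧ X_disp ⇒ P pointwise (tame genericity is monotone but not ∧-closed, so the rough horizonless
data DR ∖ CK, on which the C² conclusion
is argued false datum-by-datum, must ride inside the one generic quantifier); FinalStateConjecture ⇒
#5
(Sketch: genericCensoredHolesOrRoughSettle_of_finalStateConjecture) and GenericCensoredHolesSettle ⇒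
#5 on any X all of whose admissible
data are CK-regular. [difficulty: open-problem]
ASIDES (rev 7). The DR-class items DrainImpliesDisperse (stmt-FinalStateConjecture-17283),
CensoredHorizonlessDisperse (stmt-17284) and
GenericCensoredHolesSettle (stmt-17285) stay in this file as banked records, outside the cone of
`closes` and no longer staffed BY THIS
ROUTE: the first two are argued FALSE AS TYPED (focusing channel above; for 17284 also the
positive-mass breather caveat), the third is
superseded by #5; their decls are kept (not restated in place, not dropped) because stmt-17283 /
stmt-17284 are shared with routes
NoNullFinalMomentum / PenroseDeficitNorm (whose planners repair their own copies — C′ = CK without H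
is the recommended form for
NoNullFinalMomentum, whose `closes` has no horizon case split) and because twelve landed Theorems/
and Cruxes/ modules name them
(Reduction p149007, VisibleEnd p166259, MinkowskiEnd p150058, the Negative/ lemmas,
GenericCensoredHolesSettleReduction, the three
Lines/birth skeletons, Surgery_c6): every one of them keeps elaborating, and the monotonicity lemmas
drainImpliesDisperseCKH_of /
censoredHorizonlessDisperseCK_of (Sketch.lean, Surgery_c6 §1) turn any proof of an old item into a
proof of the new one.
(Revision history, rev 2–6; details in git.) Rev 2 (2026-08-15, cone repair): support item
MinkowskiNoHorizon and the import
Literature.Geometry.Lorentzian.MinkowskiCauchyDevelopment dropped (a refuted named fact in its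
closure kept the route unstaffed); import
Literature.Geometry.Lorentzian.CutBondiMass (definition N1) added; #2/#4 typed. Rev 3/4 (2026-08-16,
Statement re-type T2, p126844):
#2, #3, #5 restated 1:1 with the T2 conjuncts (RaysStayInClosure, honest radii in
HasExhaustiveCharts, IsFutureOriented,
IsTameChristodoulouGeneric on one end), the Assembly item restated in leaf form and later proved
(stmt-17340,
bondiDrainDispersal_assembly_proof). Rev 6 (2026-08-16): `closes` re-certified in LEAF form
HorizonlessMustDrain → DrainImpliesDisperse →
GenericCensoredHolesSettle → FinalStateConjecture after a stale-fullbuild glue stamp (orphan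
Theorems/BondiDrainDispersalAssembly.lean).
(Rev 7, 2026-08-17, route-repair rk-bdd-restate, unit
rtask-FinalStateConjecture-BondiDrai-d3293140.) The stuck restate of ranking §4 is
executed as ADD + RE-GLUE + ASIDE: three new decls DrainImpliesDisperseCKH (#2),
CensoredHorizonlessDisperseCK (#3),
GenericCensoredHolesOrRoughSettle (#5) — texts = Surgery_c6.lean C″ / CensoredHorizonlessDisperseCK
/ GenericCensoredHolesSettleR4, chosen
by the crux's lead c6 after six cycles (REPORT-c2…c6, PICKED.md) — and `closes` re-proved over them
(Sketch.lean rc 0, 0 sorry, axioms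
propext/Classical.choice/Quot.sound; the extra case split `by_cases hCK` sends rough horizonless
data to #5). Probes before filing: BC7
`#h21_crux_probe … summit := FinalStateConjecture` CLEAN for all four cone cruxes (P1/P2/P2h ok, P5:
C → S not closed); BC2 battery
(exact? | simpa | unfold; simpa | aesop, 400k heartbeats) FAILS on C → S for the three new decls and
on S → C (the term-mode proof of
S → #5 is two lines but not portfolio-cheap); negatives index: 1 entry
(UniformPhotonSphereChannels), unrelated. Why not `--restate`: a
restate renders the old decl as a comment (or changes its meaning in place) and would break the
twelve dependent modules listed under
ASIDES; why not Statement-level R1 (make the audited class CK): Statement.lean is operator-only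
(ruling F1) — if the carrier / class of
FinalStateConjecture changes (rtask fsc-vac-probe is probing the carrier for vacuity), the new items
map 1:1: they mention only
admissibleVacuumData, AFEnd.IsSoleEnd, AFEnd.IsStronglyAsymptoticallyFlatCK,
VacuumCauchyDevelopment(.IsMaximal, .metric, .timeOrientation,
.embed, .normal, .carrier, .toCauchyDevelopment, .toSpacetime), HasCompleteNullInfinity,
CauchyDevelopment.HasVanishingFinalBondiMass,
IsNormalisedNullRayFrom / chronologicalPast (the inline horizon predicate), FinalStateDecomposition
… O 2 with exteriorOf /
RaysStayInClosure / HasExhaustiveCharts / IsFutureOriented, Kerr.IsSubextremal and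
IsTameChristodoulouGeneric … 1.
TWO-LAYER PLAN. Layer 2, by glued splits (k ≤ 3, depth 1): CensoredHorizonlessDisperseCK ⇐
HorizonlessMustDrain → DrainImpliesDisperseCKH →
CensoredHorizonlessDisperseCK (pure logic, inside `closes`). DrainImpliesDisperseCKH ⇐ the
registered skeleton r4 (Lines/birth.lean):
stub_visibleRadiativeEnd (E1–E5 + E6♭: a CK horizonless drained MGHD has a VISIBLE RADIATIVE END — a
flat chart whose late slabs are
C²-close to Minkowski with every event of J⁺(ιX) eventually in its chronological past) → the landed
reductions
settles_of_horizonlessRadiativeEnd (p149007) and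
causalFuture_subset_chronologicalPast_of_noHorizon_of_cofinal (p166259) →
DrainImpliesDisperseCKH; behind stub_visibleRadiativeEnd the card's engine K1 HyperboloidalDongSong
(asymptotically hyperboloidal vacuum
data with Trautman–Bondi mass → 0 converge to ℍ³ modulo excised sets of vanishing boundary area) →
K2 BubblesAreHolesOrNothing (a
small-neck region of a vacuum slice contains a MOTS — excluded by H — or is scale-invariantly
L²-curvature-small) → K3 WeakToC2Upgrade
(pmGH-flatness of late slices + the four CK derivatives ⇒ C² convergence on flat slabs, Luk–Oh
endgame). HorizonlessMustDrain ⇐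
(quiet-window observability from 𝓘⁺) → (quantitative Anderson–Lichnerowicz), its registered skeleton
stub_completeSector /
stub_incompleteSector. GenericCensoredHolesOrRoughSettle is not split by this route (residual; the
Kerr-stability / censorship routes own
its horizon half, nobody owns its rough half yet).

KILL CRITERIA. Close `refuted:CensoredHorizonlessDisperseCK` (and the line) on a CK-admissible datum
whose MGHD has complete 𝓘⁺, no event
horizon and no honest N = 0 decomposition — an eternal vacuum breather / geon of positive final
Bondi mass (kills #4 too), or a CK
horizonless development that drains yet never becomes C²-flat on slabs (kills #2: it would mean
nonlinear focusing beats the CK orders,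
i.e. the §2 linear count is not the truth). A refutation of #2 that needs rough (non-CK) data, or a
horizon, is NOT a kill any more: those
data are #5's and the horizon case never reaches #2 (this is exactly the rev-7 repair; the DR-class
negatives stay attached to aside
stmt-17283). A refutation of the typed horizon predicate (a censored hole whose interior carries a
future-complete null ray from X) or one
that goes ONLY through the T2 conjuncts (an honest dispersive development all of whose flat late
charts violate RaysStayInClosure or
IsFutureOriented) is a Statement-typing finding reported upward, not a kill of the line.
GenericCensoredHolesOrRoughSettle refuted ⇒
¬FinalStateConjecture outright (it is a consequence of S): every route dies. Proved elsewhere: a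
dispersal-threshold or LaSalle–Bondi
route proving 'CK + horizonless + censored ⇒ disperse' moots #2–#4.

NOT DECOMPOSED YET. K1–K3 (hyperboloidal Dong–Song; bubbles are holes or nothing; weak-to-C² upgrade
at CK regularity) sit behind the single
registered stub stub_visibleRadiativeEnd of #2's skeleton and are NOT items; the
asymptotically-hyperboloidal data class / Trautman–Bondi
mass definitions they need are not requested (only N1 exists). K4 (no massless holes) is no longer
needed (H). The rough half of #5
(DR ∖ CK horizonless data settle or are tame-codimension ≥ 1) is deliberately undecomposed: it is
residual, and its natural resolution is
Statement-level (R1: audited class := CK), which only the operator can do. Constants (ε-regularity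
thresholds, Dong–Song neck-area
function) are not named.

CHEAPEST FALSIFIER. The rev-1 falsifier WAS RUN (lead c3, 2026-08-17): smallness of the level-set
mass integrand controls only
‖Γ‖, not ‖Riem‖ pointwise, and the explicit draining ripple r^(−a) sin(r^b) focuses to C² size
t^(3b−a−2) on the DR class — hence rev 7.
Cheapest check of the REPAIRED line, paper-and-pencil, one day: redo the §2 count NONLINEARLY to
second order for CK data — does the
quadratic interaction of two incoming ℓ = 2 ripples at CK rates (a > 4b + 3/2) regenerate a focused
C² pulse that the linear table says
decays (a semilinear 'self-focusing' gain of one power of ω would suffice to kill #2 at k = 2 while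
leaving k = 1)? Expected: no (null
structure of the vacuum equations; Luk–Oh large dispersive stability is exactly this regime), which
is why #2 is ranked hardest but alive.
Second cheapest: the typed horizon predicate and RaysStayInClosure on the Minkowski development
(slab achronality p156690, MinkowskiEnd
p150058: the CK Minkowski datum satisfies #2's conclusion — anti-vacuity of the repaired crux).

NUMBERS. Dong–Song: (M_i, g_i) AF, R ≥ 0, m_ADM(g_i) → 0 ⇒ ∃ Z_i ⊂ M_i with Area(∂Z_i) → 0 and (M_i
∖ Z_i, g_i, p_i) → (ℝ³, δ, 0) in pmGH
(doi:10.1007/s00222-024-01302-z, Thm 1.1). Level-set mass formula: m ≥ (16π)⁻¹ ∫ (|∇²u|²/|∇u| +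
R|∇u|) (Bray–Kazaras–Khuri–Stern;
spacetime version doi:10.4310/jdg/1669998184, Thm 1.2). Hyperbolic/hyperboloidal PMT stability: only
in symmetry or for graphs
(doi:10.1007/s10714-017-2291-y, doi:10.1007/s10455-019-09674-9, doi:10.1007/s10714-023-03176-7).
Kerr stability: |a|/M ≪ 1
(KlainermanSzeftel2023). Items at open: 4 typed (2 cruxes, 1 support, assembly) + 2 informal cruxes
+ 1 definition request; after rev 2: 5 typed (4 cruxes ranked 2–5, assembly), 0 informal, N1 landed
(CutBondiMass.lean); rev 3/4 (re-type T2): same 5 decls, 3 cruxes + the assembly restated (new item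
ids), closes crux-only over #3 and #5. Rev 7 (route-repair rk-bdd-restate): 8 decls in the file —
cone of `closes` = 4 cruxes (#2 DrainImpliesDisperseCKH, #3
CensoredHorizonlessDisperseCK, #4 HorizonlessMustDrain, #5 GenericCensoredHolesOrRoughSettle), 3
asides (stmt-17283/17284/17285, DR-class
records), 1 closed assembly (stmt-17340, rev-6 shape); CK orders (n_h, n_k) = (4, 3) vs DR (2, 1);
focusing exponent 3b − a − 2 (DR window
2b + 1 < a < 3b − 2 non-empty iff a > 7) vs the CK constraint, under which every focused C^k size
with k ≤ 3 decays (REPORT-c3 §2).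

DEFINITION REQUESTS. N1 (filed --for DrainImpliesDisperse; LANDED 2026-08-15 as
Literature/Geometry/Lorentzian/CutBondiMass.lean — `CauchyDevelopment.RoundSectionFamily`,
`HasCutBondiMass`, `cutBondiMass`, `HasVanishingFinalBondiMass`, eventual-≤-ε form):
`CauchyDevelopment.cutBondiMass` / `CauchyDevelopment.HasVanishingFinalBondiMass` in
Literature/Geometry/Lorentzian (next to BondiMass.lean, whose `BondiFoliation` is over the
uninhabited `Development` and whose cones
issue only from compact pieces of X): for a Cauchy development 𝒟 and a compact K ⊆ M, the Bondi mass
of the cut 𝓘⁺ ∩ ∂J⁺(K) rendered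
intrinsically as the limit of the Hawking masses (`LorentzianMetric.hawkingMass`) of ASYMPTOTICALLY
ROUND (Gauss curvature × area/4π → 1
uniformly) compact spacelike sections receding to infinity (area → ∞) along the achronal boundary
frontier(J⁺(K)) with L tangent to its
generators (Christodoulou–Klainerman 1993, Ch. 17, 17.0.1–17.0.9; Bondi–van der Burg–Metzner 1962);
`HasVanishingFinalBondiMass 𝒟 :=
∀ ε > 0, ∃ K compact, ∃ such a section family with limsup of Hawking masses ≤ ε` (inf over cuts and
frames = final rest mass, by mass loss
and positivity of the Bondi 4-momentum). The typed horizon predicate used inline in both cruxes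
deserves a name
(`CauchyDevelopment.HasEventHorizonRay`) but is not requested, to keep the two statements
self-contained. Rev 7 requests nothing new: `AFEnd.IsStronglyAsymptoticallyFlatCK`
(AsymptoticFlatness.lean) is already in the
Statement's import cone.

Novelty: Searches (2026-08-15): `lit search --source crossref "stability of the positive mass theorem
asymptotically hyperbolic"` (12: Sakovich
2021, Sakovich–Sormani 2017, Cabrera Pacheco 2019/2023, Dong 2024 — no general AH Dong–Song
theorem); `lit search --source crossref "final
Bondi mass vanishing dispersal vacuum Einstein asymptotically flat"` (12, none on a drain ⇒ disperse
criterion; HKK 2022 surfaces); `lit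
search --source crossref "global nonlinear stability of large dispersive solutions"` (Luk–Oh 2022);
`lit search --source crossref
"non-existence of time-periodic vacuum"` (Alexakis–Schlue JDG 2018, Bičák–Scholtz–Tod 2010); `lit
frontier FinalStateConjecture --since
2021` (30 rows: trapped-surface formation, Kerr–dS, smooth-null-infinity V, exterior-naked
singularities — no PMT-stability or Bondi-drain
descendant); `lit galaxy search "Bondi mass tends to zero dispersion" --star all` (0), `"radiates
away all of its mass" --star all` (0),
`"Bondi mass" --star pdf` (8: memory/BMS-frame numerics, Shen exterior stability, none relevant);
openalex/s2/zbmath rate-limited or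
empty, local searchd unavailable (rc 75) — logged. Ideas/ dir (66 cards): Dong–Song appears only in
weak-topology-kerr-rigidity-stability (as a
FORMAT near Kerr) and no-parking-without-horizon-komar (J2, Cauchy-slice small-ADM-mass criterion);
`ledger negatives`: 0.
Nearest prior art found: doi:10.1007/s00222-024-01302-z (Dong–Song: Riemannian, AF, no dynamics);
doi:10.1007/s10714-017-2291-y
(Sakovich–Sormani:  [refs: 10.1007/s00222-024-01302-z, 10.1007/s10714-017-2291-y, 10.1007/s00023-021-01148-8, 10.4310/jdg/1513998029, doi:10.1007/s00222-024-01302-z, doi:10.1007/s10714-017-2291-y, doi:10.1007/s00023-021-01148-8, doi:10.4310/jdg/1513998029]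

Barriers (technique_class: positive-mass-stability, dispersal-criterion, no-soliton): - technique_class: positive-mass-stability, dispersal-criterion, no-soliton
- Literature.Barriers.FinalStateConjecture.WaveCoordinatesNullConditionFailure: #2/#3 sit OUTSIDE —
the C² endgame (K3 / stub_visibleRadiativeEnd) runs from a late, already nearly flat hyperboloidal
slice with Luk–Oh / Lindblad–Rodnianski weak-null technology; the level-set coordinates are harmonic
on the SLICE (elliptic); no wave-coordinate null-condition iteration from the initial data is
implied.
- Literature.Barriers.FinalStateConjecture.KehrbergerLogarithmicAsymptotics
(NonSmoothNullInfinity.lean): OUTSIDE — no conformal compactification and no peeling is used;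
completeness of 𝓘⁺ is the Statement's sojourn form, the horizon is ray-theoretic, N1 renders the
Bondi mass through Hawking masses of receding sections (Christodoulou–Klainerman Ch. 17), which need
only the decay the CK class provides; rev 7 makes this explicit: #2/#3 quantify over CK data
exactly, the class for which CK 1993 controls 𝓘⁺ without smoothness, and the visible-radiative-end
stub asks for C² slab decay in the interior wave zone, not for an expansion in 1/r.
- Literature.Barriers.FinalStateConjecture.SbierskiTrappingObstruction
(TrappingDerivativeLoss.lean): bites a horizonless development only if its late region still traps
null geodesics; #2's hypotheses (drain + no horizon) and its engine (smallness on late hyperboloids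
after Dong–Song) place the endgame in the small-data regime where no trapping survives — the bet; a
CK hori

History (route lifecycle, newest last):
- 2026-08-15T16:18:18Z · rev 2: dropped MinkowskiNoHorizon — cone repair (rrepair g2): (1) drop support item MinkowskiNoHorizon (rank 9, unused hypothesis of closes) and the import Literature.Geometry.Lorentzian.Minkowski (planner-rrepair-FinalStateConjecture-BondiDrai-2f23d690-g2-0)
- 2026-08-16T23:13:24Z · rev 3: restated DrainImpliesDisperse (stmt-FinalStateConjecture-9970), CensoredHorizonlessDisperse (stmt-FinalStateConjecture-9921), GenericCensoredHolesSettle (stmt-FinalStateConjecture-9922) — route-repair (statement-revised, re-type T2 p126844): restate 1:1 DrainImpliesDisperse + CensoredHorizonlessDisperse (N = 0 c (planner-rrepair-FinalStateConjecture-BondiDrai-e5021adb-0)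
- 2026-08-16T23:16:29Z · rev 4: restated Assembly (stmt-FinalStateConjecture-9924 proved) — route-repair follow-up (re-type T2): restate the Assembly item in leaf form HorizonlessMustDrain → DrainImpliesDisperse → GenericCensoredHolesSettle → FinalStat (planner-rrepair-FinalStateConjecture-BondiDrai-e5021adb-0)
- 2026-08-26T15:42:30Z · DORMANT — reconciler: no traction for 6.2 d (last activity item-proof-filed at 2026-08-20T09:19:09Z); parked, not closed — `ledger route dormant route-FinalStateConjectur (operator:999:2765970)
- 2026-08-30T14:34:08Z · REACTIVATED — reconciler: reactivated — activity item-evidence-added at 2026-08-30T13:26:22Z after parking at 2026-08-26T15:42:30Z (operator:999:3815251)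
- 2026-09-04T23:03:08Z · DORMANT — reconciler: no traction for 5 d (last activity item-evidence-added at 2026-08-30T22:29:22Z); parked, not closed — `ledger route dormant route-FinalStateConjectu (operator:999:2120536)

sub-problem: FinalStateConjecture · status: dormant · opened planner-plancard-FinalStateConjecture-FinalSt-8ab0f955-0 2026-08-15T14:56:34Z · rev 8 · ledger route-FinalStateConjecture-BondiDrainDispersal
GENERATED by the gate from the ledger (D-0016/17). Provers cite these decls: `theorem foo : Summit.FinalStateConjecture.FinalStateConjecture.Theses.BondiDrainDispersal.<Decl> := …` in Summits/FinalStateConjecture/FinalStateConjecture/Theorems/<Name>.lean.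
-/

namespace Summit.FinalStateConjecture.FinalStateConjecture.Theses.BondiDrainDispersal

open scoped BigOperators Topology Manifold Classical MeasureTheory ProbabilityTheory Matrix InnerProductSpace ComplexConjugate ContinuousMap
open Filter Set Function TopologicalSpace MeasureTheory

attribute [summit_statement] _root_.FinalStateConjecture

/-- item stmt-FinalStateConjecture-18656 · crux · rank 2 · open · by planner
why it might fail: Even for CK data with no horizon, M_B ↓ 0 gives no pointwise interior control: C²-flat late slabs need a LARGE-data high-frequency dispersal theorem (nonlinear self-focusing could beat the linear CK count; Burnett: m → 0 with ‖Riem‖_L² → ∞); AH PMT stability: symmetry only.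
sources: ChristodoulouKlainerman1993, DongSong2024, LukOh2022, HirschKazarasKhuri2022, arXiv:1907.10743, Kehrberger2022AHP
[crux] DrainImpliesDisperseCKH (rev 7; C″ of Cruxes/DrainImpliesDisperse/Surgery_c6.lean; supersedes
IN THIS ROUTE the DR-class DrainImpliesDisperse stmt-FinalStateConjecture-17283, kept as an aside).
For every admissible datum D with a sole strongly asymptotically flat CHRISTODOULOU–KLAINERMAN end
(`AFEnd.IsStronglyAsymptoticallyFlatCK`: fall-off (3/2, 5/2) to derivative orders (4, 3)) and every
maximal vacuum Cauchy development 𝒟 of D with complete future null infinity (sojourn form) and no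
event horizon in the intrinsic ray-theoretic sense (it is false that some event q lies outside the
chronological past I⁻(γ(dom ∩ [0,∞))) of every future-complete normalised null ray γ from the data
hypersurface): if the final Bondi mass vanishes (`HasVanishingFinalBondiMass`, N1) then 𝒟 carries
the Statement's honest N = 0 decomposition verbatim (d.N = 0, O = exteriorOf d.charted,
RaysStayInClosure O, HasExhaustiveCharts d, IsFutureOriented d). CK because on the DR class a
draining ripple r^(−a) sin(r^b) focuses to C² size t^(3b−a−2) (REPORT-c3 §2; Negative/ lemmas modulo
RoughFramedAxisPulses…Exists) while the CK orders make it decay; H because `closes` uses the crux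
only in the horizonless b -/
@[route_item "route-FinalStateConjecture-BondiDrainDispersal"]
def DrainImpliesDisperseCKH : Prop :=
  ∀ (X : Type) [TopologicalSpace X] [ChartedSpace Literature.Geometry.Lorentzian.E3 X] [IsManifold (𝓡 3) ((⊤ : ℕ∞) : WithTop ℕ∞) X] [T2Space X] [SecondCountableTopology X] [ConnectedSpace X], ∀ D ∈ Literature.Geometry.Lorentzian.admissibleVacuumData X, (∃ (e : Literature.Geometry.Lorentzian.AFEnd X) (M : ℝ), e.IsSoleEnd ∧ e.IsStronglyAsymptoticallyFlatCK D M) → ∀ 𝒟 : Literature.Geometry.Lorentzian.VacuumCauchyDevelopment D, 𝒟.IsMaximal → Summit.FinalStateConjecture.HasCompleteNullInfinity 𝒟.toCauchyDevelopment → ¬ (∀ [𝒟.metric.HasLeviCivita], ∃ q : 𝒟.carrier, ∀ (p : X) (γ : ℝ → 𝒟.carrier) (dom : Set ℝ), 𝒟.metric.IsNormalisedNullRayFrom 𝒟.timeOrientation 𝒟.embed 𝒟.normal p γ dom → ¬ BddAbove dom → q ∉ 𝒟.metric.chronologicalPast 𝒟.timeOrientation (γ '' (dom ∩ Set.Ici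 0))) → 𝒟.toCauchyDevelopment.HasVanishingFinalBondiMass → ∃ (O : Set 𝒟.carrier) (d : Literature.Geometry.Lorentzian.FinalStateDecomposition 𝒟.toSpacetime O 2), d.N = 0 ∧ O = Summit.FinalStateConjecture.exteriorOf 𝒟.toCauchyDevelopment d.charted ∧ Summit.FinalStateConjecture.RaysStayInClosure 𝒟.toCauchyDevelopment O ∧ Summit.FinalStateConjecture.HasExhaustiveCharts d ∧ Summit.FinalStateConjecture.IsFutureOriented d

/-- item stmt-FinalStateConjecture-18657 · crux · rank 3 · open · by planner
why it might fail: ∀-data claim on the CK class: one eternal horizonless vacuum breather with complete 𝓘⁺ and final Bondi mass M_∞ > 0 refutes it (no-soliton theorems cover only stationary / time-periodic vacuum); T2: or a CK dispersive development with a complete null ray from X off closure O of every flat chart.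
sources: AlexakisSchlue2018, BicakScholtzTod2010, Anderson2000, ChristodoulouKlainerman1993, DongSong2024, LukOh2022
[crux] CensoredHorizonlessDisperseCK (rev 7; supersedes IN THIS ROUTE the DR-class
CensoredHorizonlessDisperse stmt-FinalStateConjecture-17284, kept as an aside; Surgery_c6.lean §2).
For every admissible datum D with a sole strongly asymptotically flat CK end and every maximal
vacuum Cauchy development 𝒟 of D: if 𝒟 has complete future null infinity (sojourn form) and no event
horizon in the intrinsic ray-theoretic sense (it is false that some event q lies outside the
chronological past I⁻(γ(dom ∩ [0,∞))) of every future-complete normalised null ray γ from the data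
hypersurface), then there are O and a C² final-state decomposition d of O with d.N = 0, O =
exteriorOf d.charted, RaysStayInClosure O, HasExhaustiveCharts d (honest radii) and IsFutureOriented
d — the N = 0 conclusion of the Statement verbatim. Composite of HorizonlessMustDrain (rank 4) and
DrainImpliesDisperseCKH (rank 2): built inside `closes` as `have hA`, so a direct proof of it plus
the generic branch also decides the Statement. [replaces-in-route: CensoredHorizonlessDisperse]
[deps: HorizonlessMustDrain, DrainImpliesDisperseCKH] [difficulty: open-problem] -/
@[route_item "route-FinalStateConjecture-BondiDrainDispersal"]
def CensoredHorizonlessDisperseCK : Prop :=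
  ∀ (X : Type) [TopologicalSpace X] [ChartedSpace Literature.Geometry.Lorentzian.E3 X] [IsManifold (𝓡 3) ((⊤ : ℕ∞) : WithTop ℕ∞) X] [T2Space X] [SecondCountableTopology X] [ConnectedSpace X], ∀ D ∈ Literature.Geometry.Lorentzian.admissibleVacuumData X, (∃ (e : Literature.Geometry.Lorentzian.AFEnd X) (M : ℝ), e.IsSoleEnd ∧ e.IsStronglyAsymptoticallyFlatCK D M) → ∀ 𝒟 : Literature.Geometry.Lorentzian.VacuumCauchyDevelopment D, 𝒟.IsMaximal → Summit.FinalStateConjecture.HasCompleteNullInfinity 𝒟.toCauchyDevelopment → ¬ (∀ [𝒟.metric.HasLeviCivita], ∃ q : 𝒟.carrier, ∀ (p : X) (γ : ℝ → 𝒟.carrier) (dom : Set ℝ), 𝒟.metric.IsNormalisedNullRayFrom 𝒟.timeOrientation 𝒟.embed 𝒟.normal p γ dom → ¬ BddAbove dom → q ∉ 𝒟.metric.chronologicalPast 𝒟.timeOrientation (γ '' (dom ∩ Set.Ici 0))) → ∃ (O : Set 𝒟.carrier) (d : Literature.Geometry.Lorentzian.FinalStateDecomposition 𝒟.toSpacetime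 O 2), d.N = 0 ∧ O = Summit.FinalStateConjecture.exteriorOf 𝒟.toCauchyDevelopment d.charted ∧ Summit.FinalStateConjecture.RaysStayInClosure 𝒟.toCauchyDevelopment O ∧ Summit.FinalStateConjecture.HasExhaustiveCharts d ∧ Summit.FinalStateConjecture.IsFutureOriented d

/-- item stmt-FinalStateConjecture-9976 · crux · rank 4 · open · by planner
why it might fail: Nothing known forces the news to flow while M_B > 0 without a horizon: only stationary (Lichnerowicz; Anderson2000 Thm 0.1) and time-periodic (BicakScholtzTod2010; AlexakisSchlue2018) vacuum solitons are excluded; an almost-periodic horizonless breather with complete 𝓘⁺ and M_B ↓ M_∞ > 0 refutes it.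
sources: AlexakisSchlue2018, BicakScholtzTod2010, Anderson2000, Christodoulou1991, arXiv:1312.1989, ChristodoulouKlainerman1993
[crux] HorizonlessMustDrain (the no-soliton theorem at 𝓘⁺; first half of
CensoredHorizonlessDisperse; shared in spirit with cards no-parking-without-horizon-komar and
lasalle-bondi-lyapunov-liouville). For EVERY admissible datum D and EVERY maximal vacuum Cauchy
development 𝒟 of D with complete future null infinity (sojourn form) and NO EVENT HORIZON in the
ray-theoretic sense of CensoredHorizonlessDisperse (every event q ∈ M lies in the chronological past
I⁻(γ(dom ∩ [0,∞))) of some future-complete normalised null ray γ from the data hypersurface), the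
Bondi mass drains: `𝒟.toCauchyDevelopment.HasVanishingFinalBondiMass` (definition request N1: for
every ε > 0 a compact K ⊆ M whose cut 𝓘⁺ ∩ ∂J⁺(K) has Bondi mass ≤ ε, Bondi mass of a cut = limit of
Hawking masses of asymptotically round receding sections of frontier(J⁺(K))). In words: a censored,
horizonless vacuum development radiates away ALL of its mass. Intended signature: binder and
hypotheses of CensoredHorizonlessDisperse verbatim, conclusion
`𝒟.toCauchyDevelopment.HasVanishingFinalBondiMass` (set-signature once N1 lands). Why it might fail:
only stationary (Lichnerowicz; Anderson) and time-periodic-near-𝓘⁺ (AlexakisSchlue201 -/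
@[route_item "route-FinalStateConjecture-BondiDrainDispersal"]
def HorizonlessMustDrain : Prop :=
  ∀ (X : Type) [TopologicalSpace X] [ChartedSpace Literature.Geometry.Lorentzian.E3 X] [IsManifold (𝓡 3) ((⊤ : ℕ∞) : WithTop ℕ∞) X] [T2Space X] [SecondCountableTopology X] [ConnectedSpace X], ∀ D ∈ Literature.Geometry.Lorentzian.admissibleVacuumData X, ∀ 𝒟 : Literature.Geometry.Lorentzian.VacuumCauchyDevelopment D, 𝒟.IsMaximal → Summit.FinalStateConjecture.HasCompleteNullInfinity 𝒟.toCauchyDevelopment → ¬ (∀ [𝒟.metric.HasLeviCivita], ∃ q : 𝒟.carrier, ∀ (p : X) (γ : ℝ → 𝒟.carrier) (dom : Set ℝ), 𝒟.metric.IsNormalisedNullRayFrom 𝒟.timeOrientation 𝒟.embed 𝒟.normal p γ dom → ¬ BddAbove dom → q ∉ 𝒟.metric.chronologicalPast 𝒟.timeOrientation (γ '' (dom ∩ Set.Ici 0))) → 𝒟.toCauchyDevelopment.HasVanishingFinalBondiMass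

/-- item stmt-FinalStateConjecture-18658 · crux · rank 5 · open · by planner
why it might fail: = large-data weak cosmic censorship + Kerr stability / final-state uniqueness, all |a| < M, tame-generically, PLUS the conjecture on rough data DR ∖ CK (dense, not known tame-codim ≥ 1); known: |a| ≪ M (KlainermanSzeftel2023); dies on an open set of naked singularities or rough non-settling data.
sources: DafermosLuk2017, KlainermanSzeftel2023, GiorgiKlainermanSzeftel2022, DafermosHolzegelRodnianskiTaylor2021, Christodoulou1999, Kehrberger2022AHP
[crux] GenericCensoredHolesOrRoughSettle (rev 7; the route's declared RESIDUAL; R4 of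
Surgery_c6.lean §3; supersedes IN THIS ROUTE GenericCensoredHolesSettle
stmt-FinalStateConjecture-17285, kept as an aside). For every data manifold X,
TAME-Christodoulou-generically in the admissible class (`IsTameChristodoulouGeneric
(admissibleVacuumData X) · 1`): an MGHD exists, and every MGHD has complete future null infinity
and, IF it has an event horizon (ray-theoretic sense) OR the datum has NO sole strongly
asymptotically flat CK end (the rough class DR ∖ CK), admits O and a C² final-state decomposition d
with every (d.mass i, d.spin i) sub-extremal, O = exteriorOf d.charted, RaysStayInClosure O,
HasExhaustiveCharts d, IsFutureOriented d. The weakest single generic property Q with Q ∧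
CensoredHorizonlessDisperseCK ⇒ the Statement's property pointwise (tame genericity is monotone in
the property but not ∧-closed, so the rough horizonless data must ride inside the one generic
quantifier). FinalStateConjecture ⇒ it (two lines, Sketch
genericCensoredHolesOrRoughSettle_of_finalStateConjecture): a consequence of S used toward S;
GenericCensoredHolesSettle ⇒ it whenever all admissible data on X -/
@[route_item "route-FinalStateConjecture-BondiDrainDispersal"]
def GenericCensoredHolesOrRoughSettle : Prop :=
  ∀ (X : Type) [TopologicalSpace X] [ChartedSpace Literature.Geometry.Lorentzian.E3 X] [IsManifold (𝓡 3) ((⊤ : ℕ∞) : WithTop ℕ∞) X] [T2Space X] [SecondCountableTopology X] [ConnectedSpace X], Literature.Geometry.Lorentzian.InitialDataSet.IsTameChristodoulouGeneric (Literature.Geometry.Lorentzian.admissibleVacuumData X) (fun D ↦ (∃ 𝒟 : Literature.Geometry.Lorentzian.VacuumCauchyDevelopment D, 𝒟.IsMaximal) ∧ ∀ 𝒟 : Literature.Geometry.Lorentzian.VacuumCauchyDevelopment D, 𝒟.IsMaximal → Summit.FinalStateConjecture.HasCompleteNullInfinity 𝒟.toCauchyDevelopment ∧ (((∀ [𝒟.metric.HasLeviCivita],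 ∃ q : 𝒟.carrier, ∀ (p : X) (γ : ℝ → 𝒟.carrier) (dom : Set ℝ), 𝒟.metric.IsNormalisedNullRayFrom 𝒟.timeOrientation 𝒟.embed 𝒟.normal p γ dom → ¬ BddAbove dom → q ∉ 𝒟.metric.chronologicalPast 𝒟.timeOrientation (γ '' (dom ∩ Set.Ici 0))) ∨ ¬ (∃ (e : Literature.Geometry.Lorentzian.AFEnd X) (M : ℝ), e.IsSoleEnd ∧ e.IsStronglyAsymptoticallyFlatCK D M)) → ∃ (O : Set 𝒟.carrier) (d : Literature.Geometry.Lorentzian.FinalStateDecomposition 𝒟.toSpacetime O 2), (∀ i, Literature.Geometry.Lorentzian.Kerr.IsSubextremal (d.mass i) (d.spin i)) ∧ O = Summit.FinalStateConjecture.exteriorOf 𝒟.toCauchyDevelopment d.charted ∧ Summit.FinalStateConjecture.RaysStayInClosure 𝒟.toCauchyDevelopment O ∧ Summit.FinalStateConjecture.HasExhaustiveCharts d ∧ Summit.FinalStateConjecture.IsFutureOriented d)) 1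

-- earlier DrainImpliesDisperse (stmt-FinalStateConjecture-9970, replaced 2026-08-16T23:13:24Z -> stmt-FinalStateConjecture-17283): retired by None — ∀ (X : Type) [TopologicalSpace X] [ChartedSpace Literature.Geometry.Lorentzian.E3 X] [IsManifold (𝓡 3) ((⊤ : ℕ∞) : WithTop ℕ∞) X] [T2Space X] [SecondCountableTopology X] [ConnectedSpace X], ∀ D ∈ Literature.Geometry.Lorentzian.admissibleVacuumData X, ∀ 
/-- item stmt-FinalStateConjecture-17283 · aside · rank 2 · open · by planner
why it might fail: M_B ↓ 0 gives no pointwise control: 'massless holes' (a MOTS persisting while M_B → 0) are excluded only by an unproved late-cut Penrose bound, and a complete null ray from X inside one breaks RaysStayInClosure (T2); Burnett data: m → 0 with ‖Riem‖_L² → ∞, so C² flatness can fail; AH PMT: symmetry.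
sources: DongSong2024, HirschKazarasKhuri2022, arXiv:2504.10641, Mars2009, LukOh2022, arXiv:1907.10743
[crux] DrainImpliesDisperse (card pmt-almost-rigidity-bubbles-are-holes, spine; the second half of
CensoredHorizonlessDisperse; rev 3: restated 1:1 after the Statement re-type T2, p126844). For EVERY
admissible datum D and EVERY maximal vacuum Cauchy development 𝒟 of D: if 𝒟 has complete future null
infinity (Summit.FinalStateConjecture.HasCompleteNullInfinity, sojourn form) and its Bondi mass
DRAINS — the final Bondi mass vanishes, `𝒟.toCauchyDevelopment.HasVanishingFinalBondiMass`
(CutBondiMass.lean, definition N1: for every ε > 0 some compact K ⊆ M whose cut 𝓘⁺ ∩ ∂J⁺(K) has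
Bondi mass ≤ ε, the Bondi mass of a cut being the limit of the Hawking masses of asymptotically
round compact spacelike sections receding to infinity along frontier(J⁺(K))) — then 𝒟 carries an
honest dispersive final-state decomposition, i.e. the re-typed Statement's N = 0 conclusion
verbatim: ∃ (O : Set 𝒟.carrier) (d : FinalStateDecomposition 𝒟.toSpacetime O 2), d.N = 0 ∧ O =
exteriorOf 𝒟 d.charted ∧ RaysStayInClosure 𝒟 O (every future-complete normalised null ray from X
stays in closure O) ∧ HasExhaustiveCharts d (growing honest radii; for N = 0: every point of O not
in the flat chart's late region is causa -/
@[route_item "route-FinalStateConjecture-BondiDrainDispersal"]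
def DrainImpliesDisperse : Prop :=
  ∀ (X : Type) [TopologicalSpace X] [ChartedSpace Literature.Geometry.Lorentzian.E3 X] [IsManifold (𝓡 3) ((⊤ : ℕ∞) : WithTop ℕ∞) X] [T2Space X] [SecondCountableTopology X] [ConnectedSpace X], ∀ D ∈ Literature.Geometry.Lorentzian.admissibleVacuumData X, ∀ 𝒟 : Literature.Geometry.Lorentzian.VacuumCauchyDevelopment D, 𝒟.IsMaximal → Summit.FinalStateConjecture.HasCompleteNullInfinity 𝒟.toCauchyDevelopment → 𝒟.toCauchyDevelopment.HasVanishingFinalBondiMass → ∃ (O : Set 𝒟.carrier) (d : Literature.Geometry.Lorentzian.FinalStateDecomposition 𝒟.toSpacetime O 2), d.N = 0 ∧ O = Summit.FinalStateConjecture.exteriorOf 𝒟.toCauchyDevelopment d.charted ∧ Summit.FinalStateConjecture.RaysStayInClosure 𝒟.toCauchyDevelopment O ∧ Summit.FinalStateConjecture.HasExhaustiveCharts d ∧ Summit.FinalStateConjecture.IsFutureOriented d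

-- earlier CensoredHorizonlessDisperse (stmt-FinalStateConjecture-9921, replaced 2026-08-16T23:13:24Z -> stmt-FinalStateConjecture-17284): moot by None — ∀ (X : Type) [TopologicalSpace X] [ChartedSpace Literature.Geometry.Lorentzian.E3 X] [IsManifold (𝓡 3) ((⊤ : ℕ∞) : WithTop ℕ∞) X] [T2Space X] [SecondCountableTopology X] [ConnectedSpace X], ∀ D ∈ Literature.Geometry.Lorentzian.admissibleVacuumData X
/-- item stmt-FinalStateConjecture-17284 · aside · rank 3 · open · by planner
why it might fail: ∀-data claim: an eternal horizonless vacuum breather with complete 𝓘⁺ and final Bondi mass M_∞ > 0 refutes it (no-soliton theorems cover only stationary/time-periodic vacuum: Anderson2000, BicakScholtzTod2010, AlexakisSchlue2018); T2: or a complete null ray from X off closure O of any flat chart.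
sources: AlexakisSchlue2018, BicakScholtzTod2010, Anderson2000, Christodoulou1991, DongSong2024, LukOh2022
[crux] CensoredHorizonlessDisperse (rev 3: restated 1:1 after the Statement re-type T2, p126844).
For every admissible datum D (Christodoulou class, Dafermos–Rodnianski fall-off) and every maximal
vacuum Cauchy development 𝒟 of D: if 𝒟 has complete future null infinity (sojourn form) and NO EVENT
HORIZON in the intrinsic ray-theoretic sense — it is false that some event q lies outside the
chronological past I⁻(γ(dom ∩ [0,∞))) of every future-complete normalised null ray γ from the data
hypersurface — then there are O and a C² final-state decomposition d of O with d.N = 0, O = J⁺(ιX) ∩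
I⁻(d.charted) (exteriorOf), every future-complete normalised null ray from X staying in closure O
(RaysStayInClosure), exhaustive charts with honest radii (HasExhaustiveCharts) and future-oriented
chart time (IsFutureOriented) — the N = 0 conclusion of the re-typed Statement, verbatim. Composite
of the card's HorizonlessMustDrain (rank 4) and DrainImpliesDisperse (rank 2); hypothesis of the
crux-only deciding theorem `closes`. [difficulty: open-problem] -/
@[route_item "route-FinalStateConjecture-BondiDrainDispersal"]
def CensoredHorizonlessDisperse : Prop :=
  ∀ (X : Type) [TopologicalSpace X] [ChartedSpace Literature.Geometry.Lorentzian.E3 X] [IsManifold (𝓡 3) ((⊤ : ℕ∞) : WithTop ℕ∞) X] [T2Space X] [SecondCountableTopology X] [ConnectedSpace X], ∀ D ∈ Literature.Geometry.Lorentzian.admissibleVacuumData X, ∀ 𝒟 : Literature.Geometry.Lorentzian.VacuumCauchyDevelopment D, 𝒟.IsMaximal → Summit.FinalStateConjecture.HasCompleteNullInfinity 𝒟.toCauchyDevelopment → ¬ (∀ [𝒟.metric.HasLeviCivita], ∃ q : 𝒟.carrier, ∀ (p : X) (γ : ℝ → 𝒟.carrier) (dom : Set ℝ), 𝒟.metric.IsNormalisedNullRayFrom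 𝒟.timeOrientation 𝒟.embed 𝒟.normal p γ dom → ¬ BddAbove dom → q ∉ 𝒟.metric.chronologicalPast 𝒟.timeOrientation (γ '' (dom ∩ Set.Ici 0))) → ∃ (O : Set 𝒟.carrier) (d : Literature.Geometry.Lorentzian.FinalStateDecomposition 𝒟.toSpacetime O 2), d.N = 0 ∧ O = Summit.FinalStateConjecture.exteriorOf 𝒟.toCauchyDevelopment d.charted ∧ Summit.FinalStateConjecture.RaysStayInClosure 𝒟.toCauchyDevelopment O ∧ Summit.FinalStateConjecture.HasExhaustiveCharts d ∧ Summit.FinalStateConjecture.IsFutureOriented d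

-- earlier GenericCensoredHolesSettle (stmt-FinalStateConjecture-9922, replaced 2026-08-16T23:13:24Z -> stmt-FinalStateConjecture-17285): retired by None — ∀ (X : Type) [TopologicalSpace X] [ChartedSpace Literature.Geometry.Lorentzian.E3 X] [IsManifold (𝓡 3) ((⊤ : ℕ∞) : WithTop ℕ∞) X] [T2Space X] [SecondCountableTopology X] [ConnectedSpace X], Literature.Geometry.Lorentzian.InitialDataSet.IsChristodo
/-- item stmt-FinalStateConjecture-17285 · aside · rank 5 · open · by planner
why it might fail: = large-data weak cosmic censorship + Kerr stability/final-state uniqueness on all |a| < M, TAME-generically (T2: no burial); known only for |a| ≪ M (KlainermanSzeftel2023), Schwarzschild codim-3 (DHRT2021); dies on an OPEN set of naked singularities, or a complete ray from X in a hole off closure O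
sources: DafermosLuk2017, KlainermanSzeftel2023, GiorgiKlainermanSzeftel2022, DafermosHolzegelRodnianskiTaylor2021, RodnianskiShlapentokhRothman2023, Christodoulou1999
[crux] GenericCensoredHolesSettle (rev 3: restated 1:1 after the Statement re-type T2, p126844) —
the complementary branch, carrying ALL the genericity: for every data manifold X,
TAME-Christodoulou-generically in the admissible class (`InitialDataSet.IsTameChristodoulouGeneric
(admissibleVacuumData X) · 1`: through every exceptional admissible datum passes an injective
one-parameter family of admissible data, tame on ONE fixed asymptotically flat end — jointly smooth,
Dafermos–Rodnianski rates with continuous mass M(c), wDist-continuous at c = 0 — and immersed at 0,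
all of whose other members are good): an MGHD exists, and every MGHD has complete future null
infinity and, IF it has an event horizon in the ray-theoretic sense of CensoredHorizonlessDisperse,
admits O and a C² final-state decomposition d with every (d.mass i, d.spin i) sub-extremal, O =
J⁺(ιX) ∩ I⁻(d.charted), RaysStayInClosure O, HasExhaustiveCharts d (honest radii Rᵢ ≥ max(r₊,0)+1,
Rᵢ → ∞) and IsFutureOriented d (orthochronous motions; transported Kerr timeVector and ∂₀ push
forward future-directed, eventually). (= weak cosmic censorship + the black-hole final state: the
re-typed Statement with its decomposition co -/
@[route_item "route-FinalStateConjecture-BondiDrainDispersal"]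
def GenericCensoredHolesSettle : Prop :=
  ∀ (X : Type) [TopologicalSpace X] [ChartedSpace Literature.Geometry.Lorentzian.E3 X] [IsManifold (𝓡 3) ((⊤ : ℕ∞) : WithTop ℕ∞) X] [T2Space X] [SecondCountableTopology X] [ConnectedSpace X], Literature.Geometry.Lorentzian.InitialDataSet.IsTameChristodoulouGeneric (Literature.Geometry.Lorentzian.admissibleVacuumData X) (fun D ↦ (∃ 𝒟 : Literature.Geometry.Lorentzian.VacuumCauchyDevelopment D, 𝒟.IsMaximal) ∧ ∀ 𝒟 : Literature.Geometry.Lorentzian.VacuumCauchyDevelopment D, 𝒟.IsMaximal → Summit.FinalStateConjecture.HasCompleteNullInfinity 𝒟.toCauchyDevelopment ∧ ((∀ [𝒟.metric.HasLeviCivita], ∃ q : 𝒟.carrier, ∀ (p : X) (γ : ℝ → 𝒟.carrier) (dom : Set ℝ), 𝒟.metric.IsNormalisedNullRayFrom 𝒟.timeOrientation 𝒟.embed 𝒟.normal p γ dom → ¬ BddAbove dom → q ∉ 𝒟.metric.chronologicalPast 𝒟.timeOrientation (γ '' (dom ∩ Set.Ici 0))) → ∃ (O : Set 𝒟.carrier)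 (d : Literature.Geometry.Lorentzian.FinalStateDecomposition 𝒟.toSpacetime O 2), (∀ i, Literature.Geometry.Lorentzian.Kerr.IsSubextremal (d.mass i) (d.spin i)) ∧ O = Summit.FinalStateConjecture.exteriorOf 𝒟.toCauchyDevelopment d.charted ∧ Summit.FinalStateConjecture.RaysStayInClosure 𝒟.toCauchyDevelopment O ∧ Summit.FinalStateConjecture.HasExhaustiveCharts d ∧ Summit.FinalStateConjecture.IsFutureOriented d)) 1

-- earlier Assembly (stmt-FinalStateConjecture-9924, replaced 2026-08-16T23:16:29Z -> stmt-FinalStateConjecture-17340): proved by Summit.FinalStateConjecture.FinalStateConjecture.Theorems.BondiDrainDispersal.assembly_frame_proof — CensoredHorizonlessDisperse → GenericCensoredHolesSettle → FinalStateConjecture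
/-- item stmt-FinalStateConjecture-17340 · assembly · rank 1 · closed · proved by Summit.FinalStateConjecture.FinalStateConjecture.Theorems.bondiDrainDispersal_assembly_proof @ 74fd8406a338 (prover) · by planner
sources: Christodoulou1999, DafermosLuk2017
[assembly] LEAF form of the route's assembly (rev 4, after the Statement re-type T2, p126844): the
two halves of CensoredHorizonlessDisperse — HorizonlessMustDrain (rank 4: censored + horizonless ⇒
the final Bondi mass vanishes) and DrainImpliesDisperse (rank 2: vanishing final Bondi mass ⇒ honest
N = 0 decomposition with RaysStayInClosure, exhaustive and future-oriented charts) — together with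
the generic branch GenericCensoredHolesSettle (rank 5, tame genericity) imply FinalStateConjecture.
Pure logic: HorizonlessMustDrain → DrainImpliesDisperse → CensoredHorizonlessDisperse (composition),
then the deciding theorem `closes : CensoredHorizonlessDisperse → GenericCensoredHolesSettle →
FinalStateConjecture` (tame genericity is monotone in the property; horizon case split; Fin.elim0 at
N = 0) — `fun hM hD hG ↦ closes (censoredHorizonlessDisperse_of hM hD) hG` in the planner's
Sketch.lean. Supersedes the rev-1 form `CensoredHorizonlessDisperse → GenericCensoredHolesSettle →
FinalStateConjecture`, now literally the type of `closes`, whose recorded proof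
Theorems/BondiDrainDispersalAssembly.assembly_frame_proof inlines the PRE-re-type bodies and no
longer elaborates (a prover closing th -/
@[route_item "route-FinalStateConjecture-BondiDrainDispersal"]
def Assembly : Prop :=
  HorizonlessMustDrain → DrainImpliesDisperse → GenericCensoredHolesSettle → FinalStateConjecture

-- `Assembly` holds: proved by `Summit.FinalStateConjecture.FinalStateConjecture.Theorems.bondiDrainDispersal_assembly_proof` @ 74fd8406a338 (its module imports this route file, so no `_holds` link can be stated here).

/-! D-0027 §2.1 — DECIDING THEOREM (planner-authored via `route open/edit --closes-file`; by planner-rtask-FinalStateConjecture-BondiDrai-d3293140-0 2026-08-17T16:53:04Z):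
its hypotheses are this route's items and its conclusion the sub-problem Statement (glue_lint), and it elaborates with this file. -/

@[closes "route-FinalStateConjecture-BondiDrainDispersal"] theorem closes : HorizonlessMustDrain → DrainImpliesDisperseCKH → GenericCensoredHolesOrRoughSettle → _root_.FinalStateConjecture := by
  intro hM hΔ hG
  -- the line's two strokes compose to the CK-restricted dispersive branch `CensoredHorizonlessDisperseCK`
  -- by pure logic: no event horizon ⇒ the final Bondi mass vanishes (`hM`, all DR data, a fortiori CK data)
  -- ⇒ honest `N = 0` decomposition (`hΔ`, which may use the horizonless hypothesis and the CK clause)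
  have hA : CensoredHorizonlessDisperseCK := by
    intro X _ _ _ _ _ _ D hD hCK 𝒟 h𝒟 hI hH
    exact hΔ X D hD hCK 𝒟 h𝒟 hI hH (hM X D hD 𝒟 h𝒟 hI hH)
  intro X _ _ _ _ _ _ D hD
  -- pointwise on admissible data: the property of `GenericCensoredHolesOrRoughSettle` implies the
  -- Statement's property (case split on the ray-theoretic horizon, then on CK-regularity of the datum;
  -- `hA` in the CK horizonless case; the generic branch owns the horizon case AND the rough horizonless case)
  have key : ∀ D' ∈ Literature.Geometry.Lorentzian.admissibleVacuumData X,
      ((∃ 𝒟 : Literature.Geometry.Lorentzian.VacuumCauchyDevelopment D', 𝒟.IsMaximal) ∧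
        ∀ 𝒟 : Literature.Geometry.Lorentzian.VacuumCauchyDevelopment D', 𝒟.IsMaximal →
          Summit.FinalStateConjecture.HasCompleteNullInfinity 𝒟.toCauchyDevelopment ∧
          (((∀ [𝒟.metric.HasLeviCivita], ∃ q : 𝒟.carrier, ∀ (p : X) (γ : ℝ → 𝒟.carrier) (dom : Set ℝ),
              𝒟.metric.IsNormalisedNullRayFrom 𝒟.timeOrientation 𝒟.embed 𝒟.normal p γ dom →
              ¬ BddAbove dom → q ∉ 𝒟.metric.chronologicalPast 𝒟.timeOrientation (γ '' (dom ∩ Set.Ici 0))) ∨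
            ¬ (∃ (e : Literature.Geometry.Lorentzian.AFEnd X) (M : ℝ),
                e.IsSoleEnd ∧ e.IsStronglyAsymptoticallyFlatCK D' M)) →
            ∃ (O : Set 𝒟.carrier) (d : Literature.Geometry.Lorentzian.FinalStateDecomposition 𝒟.toSpacetime O 2),
              (∀ i, Literature.Geometry.Lorentzian.Kerr.IsSubextremal (d.mass i) (d.spin i)) ∧
              O = Summit.FinalStateConjecture.exteriorOf 𝒟.toCauchyDevelopment d.charted ∧
              Summit.FinalStateConjecture.RaysStayInClosure 𝒟.toCauchyDevelopment O ∧
              Summit.FinalStateConjecture.HasExhaustiveCharts d ∧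
              Summit.FinalStateConjecture.IsFutureOriented d)) →
      ((∃ 𝒟 : Literature.Geometry.Lorentzian.VacuumCauchyDevelopment D', 𝒟.IsMaximal) ∧
        ∀ 𝒟 : Literature.Geometry.Lorentzian.VacuumCauchyDevelopment D', 𝒟.IsMaximal →
          Summit.FinalStateConjecture.HasCompleteNullInfinity 𝒟.toCauchyDevelopment ∧
            ∃ (O : Set 𝒟.carrier) (d : Literature.Geometry.Lorentzian.FinalStateDecomposition 𝒟.toSpacetime O 2),
              (∀ i, Literature.Geometry.Lorentzian.Kerr.IsSubextremal (d.mass i) (d.spin i)) ∧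
              O = Summit.FinalStateConjecture.exteriorOf 𝒟.toCauchyDevelopment d.charted ∧
              Summit.FinalStateConjecture.RaysStayInClosure 𝒟.toCauchyDevelopment O ∧
              Summit.FinalStateConjecture.HasExhaustiveCharts d ∧
              Summit.FinalStateConjecture.IsFutureOriented d) := by
    intro D' hD' h
    refine ⟨h.1, fun 𝒟 h𝒟 ↦ ⟨(h.2 𝒟 h𝒟).1, ?_⟩⟩
    by_cases hH : (∀ [𝒟.metric.HasLeviCivita], ∃ q : 𝒟.carrier, ∀ (p : X) (γ : ℝ → 𝒟.carrier) (dom : Set ℝ),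
        𝒟.metric.IsNormalisedNullRayFrom 𝒟.timeOrientation 𝒟.embed 𝒟.normal p γ dom →
        ¬ BddAbove dom → q ∉ 𝒟.metric.chronologicalPast 𝒟.timeOrientation (γ '' (dom ∩ Set.Ici 0)))
    · -- event horizon: the generic branch settles the exterior directly
      exact (h.2 𝒟 h𝒟).2 (Or.inl hH)
    · by_cases hCK : ∃ (e : Literature.Geometry.Lorentzian.AFEnd X) (M : ℝ),
          e.IsSoleEnd ∧ e.IsStronglyAsymptoticallyFlatCK D' M
      · -- CK data, no event horizon: the CK-restricted dispersive branch gives an `N = 0`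
        -- decomposition with the same three T2 clauses, whose sub-extremality clause is vacuous over `Fin 0`
        obtain ⟨O, d, hN, hO, hR, hE, hF⟩ := hA X D' hD' hCK 𝒟 h𝒟 (h.2 𝒟 h𝒟).1 hH
        exact ⟨O, d, fun i ↦ (Fin.cast hN i).elim0, hO, hR, hE, hF⟩
      · -- rough (DR ∖ CK) data, no event horizon: owned by the generic branch
        exact (h.2 𝒟 h𝒟).2 (Or.inr hCK)
  -- tame Christodoulou genericity is monotone in the property: the SAME end `e` and the SAME
  -- tame, immersed, injective admissible family `F` through `D` witness the Statement's property
  obtain ⟨e, F, hT, hImm, h0, hinj, hF𝓓, hE⟩ := hG X D ⟨hD.1, fun h ↦ hD.2 (key D hD.1 h)⟩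
  exact ⟨e, F, hT, hImm, h0, hinj, hF𝓓, fun c hc hmem ↦ hE c hc ⟨hmem.1, fun h ↦ hmem.2 (key _ hmem.1 h)⟩⟩

end Summit.FinalStateConjecture.FinalStateConjecture.Theses.BondiDrainDispersal
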